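import Literature.NumberTheory.Weil1964.AdelicMetaplecticOfArchImplementer
import Literature.NumberTheory.Weil1964.AdelicMetaplecticTensorSchur
import HarnessLib

/-!
# The archimedean factor of a tensor-form implementer is Weil-covariant (converse dictionary)

Topic `NumberTheory/Weil1964`; namespace `Literature.NumberTheory.Weil1964`.  KERNEL MATHEMATICS ONLY: proved
theorems; no definition, no `def … : Prop` record, no axiom, no proof hole.

`AdelicMetaplecticOfArchImplementer` proved: an archimedean operator `A` that is Weil-covariant over `g ∈ Sp(W_𝔸)`
(`A ρ_∞(a, w) = ψ-phase · ρ_∞(g(a, w)) A`, archimedean Heisenberg elements) gives the implementing pair `(g, A ⊗ 1)`.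
This file proves the CONVERSE: if `(g, M) ∈ Mp_ψ(W_𝔸)` and `M` has tensor form `M(Φ_∞ ⊗ f) = A Φ_∞ ⊗ M_f f` (e.g. the
output of the tensor-stripping theorem `exists_continuousLinearEquiv_map_tmul_of_mem_adelicMpCont` of
`AdelicMetaplecticTensorStripping`), then `A` is Weil-covariant over `g` on the archimedean Heisenberg elements
(**`archCovariant_of_map_tmul`**).  The point: `g` is `𝔸_F`-linear, so `g(W_∞) = W_∞` (`apply_archVec_pair`): the
implementing identity on the archimedean Heisenberg element `((a, w)_∞, 0)` and a pure tensor reads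
`A ρ_∞(a,w)Φ ⊗ M_f f = ψ(f_g) · ρ_∞(g(a,w)) AΦ ⊗ M_f f`, and the finite factor cancels (evaluate at a point where
`M_f f ≠ 0`).  Consequently (`exists_smul_carrierConj_of_map_tmul`) such an `A` is, up to a non-zero scalar, the frame
transport `e^* z e_*` of ANY element `z ∈ Mp^𝓢(ℝ^σ)` whose phase action is the dictionary of `g`
(continuous archimedean Schur, `SchwartzHeisenbergSchur`).

[Weil1964, Chap. III n° 37–38 pp. 188–190] (the standard representation of the adelic group is the restricted tensor
product of the local ones; implementers factor accordingly); [MoeglinVignerasWaldspurger1987, Chap. 2 II.1 (A)].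

## References

* [Weil1964] A. Weil, Acta Math. 111 (1964), Chap. III n° 37–38 pp. 188–190.
* [MoeglinVignerasWaldspurger1987] C. Mœglin, M.-F. Vignéras, J.-L. Waldspurger, LNM 1291 (1987), Chap. 2 II.1 (A).
-/

set_option autoImplicit false

noncomputable section

open MeasureTheory Complex SchwartzMap
open scoped TensorProduct Classical
open NumberField NumberField.mixedEmbedding IsDedekindDomain

namespace Literature.NumberTheory.Weil1964

open Literature.Analysis.SegalBargmann Literature.RepresentationTheory.HeisenbergGroup
open Literature.NumberTheory.Automorphic

variable {F : Type} [Field F] [NumberField F] {ι : Type} [Fintype ι] [DecidableEq ι]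
  {T : Matrix ι ι (AdeleRing (𝓞 F) F)}

omit [Fintype ι] [DecidableEq ι] in
/-- `f ↦ f(0 + ·)` is the identity. [cite: Weil1964, Chap. III n° 38 p. 189] -/
theorem finTranslateSB_zero (f : FinSB F ι) : finTranslateSB F ι 0 f = f :=
  Subtype.ext (funext fun b => by
    show (f : (ι → FiniteAdeleRing (𝓞 F) F) → ℂ) (0 + b) = _
    rw [zero_add])

omit [DecidableEq ι] in
/-- modulation by the trivial character is the identity. [cite: Weil1964, Chap. III n° 38 p. 189] -/
theorem finModulateSB_zero (f : FinSB F ι) : finModulateSB F ι 0 f = f :=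
  Subtype.ext (funext fun b => by
    rw [coe_finModulateSB_apply]
    simp only [Pi.zero_apply, zero_mul, Finset.sum_const_zero, AddChar.map_zero_eq_one, Circle.coe_one, one_mul])

omit [DecidableEq ι] in
/-- a pure tensor read at a split point: `(Φ ⊗ f)(u, k) = Φ(u) f(k)`. [cite: Weil1964, Chap. III n° 37 p. 188] -/
theorem coe_piSchwartzBruhatEquiv_tmul_piAdeleSplit (Φ : 𝓢((ι → mixedSpace F), ℂ)) (f : FinSB F ι)
    (u : ι → mixedSpace F) (k : ι → FiniteAdeleRing (𝓞 F) F) :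
    ((piSchwartzBruhatEquiv F ι (Φ ⊗ₜ f) : piSchwartzBruhat F ι) : (ι → AdeleRing (𝓞 F) F) → ℂ)
        (piAdeleSplit F ι (u, k)) =
      Φ u * (f : (ι → FiniteAdeleRing (𝓞 F) F) → ℂ) k := by
  simp only [coe_piSchwartzBruhatEquiv_tmul, piArch_piAdeleSplit, piFinite_piAdeleSplit]

/-- **THE ARCHIMEDEAN FACTOR OF A TENSOR-FORM IMPLEMENTER IS WEIL-COVARIANT.**  If `(g, M) ∈ Mp_ψ(W_𝔸)` and
`M(Φ_∞ ⊗ f) = A Φ_∞ ⊗ M_f f` for all pure tensors (`M_f` a linear automorphism of the finite factor), then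
`A ρ_∞(a, w) Φ = ψ_F(f_g((a,w)_∞)) · ρ_∞(g(a, w)_∞) A Φ` — the hypothesis `hA` of `archElt`.
[cite: Weil1964, Chap. III n° 37–38 pp. 188–190; MoeglinVignerasWaldspurger1987, Chap. 2 II.1 (A)] -/
theorem archCovariant_of_map_tmul (p : adelicMp F ι T)
    (A : 𝓢((ι → mixedSpace F), ℂ) ≃L[ℂ] 𝓢((ι → mixedSpace F), ℂ)) (Mf : FinSB F ι ≃ₗ[ℂ] FinSB F ι)
    (hp : ∀ (Φ : 𝓢((ι → mixedSpace F), ℂ)) (f : FinSB F ι),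
      (p : symplecticGroup (polar (adelicForm F ι T)) × (piSchwartzBruhat F ι ≃ₗ[ℂ] piSchwartzBruhat F ι)).2
          (piSchwartzBruhatEquiv F ι (Φ ⊗ₜ f)) =
        piSchwartzBruhatEquiv F ι (A Φ ⊗ₜ Mf f))
    (a w : ι → mixedSpace F) (Φ : 𝓢((ι → mixedSpace F), ℂ)) :
    A (archModTrans F ι T a w Φ) =
      weilPhase T (p : symplecticGroup (polar (adelicForm F ι T)) ×
          (piSchwartzBruhat F ι ≃ₗ[ℂ] piSchwartzBruhat F ι)).1 (a, w) •
        archModTrans F ι T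
          (archAct T (p : symplecticGroup (polar (adelicForm F ι T)) ×
            (piSchwartzBruhat F ι ≃ₗ[ℂ] piSchwartzBruhat F ι)).1 (a, w)).1
          (archAct T (p : symplecticGroup (polar (adelicForm F ι T)) ×
            (piSchwartzBruhat F ι ≃ₗ[ℂ] piSchwartzBruhat F ι)).1 (a, w)).2 (A Φ) := by
  set g := (p : symplecticGroup (polar (adelicForm F ι T)) × (piSchwartzBruhat F ι ≃ₗ[ℂ] piSchwartzBruhat F ι)).1
    with hg
  have hImp : Implements (adelicSchrodinger F ι T) (ofSymplectic (polar (adelicForm F ι T)) g)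
      (p : symplecticGroup (polar (adelicForm F ι T)) × (piSchwartzBruhat F ι ≃ₗ[ℂ] piSchwartzBruhat F ι)).2 :=
    (mem_MpPsi _ _).1 p.2
  -- a finite test vector with a non-vanishing value of `M_f f₀`
  set f₀ : FinSB F ι := indicatorSB F ι (piLevelIdeal F ι ⊤) (isOpen_piLevelIdeal F ⊤) (isCompact_piLevelIdeal F ι ⊤)
    with hf₀
  have hMf0 : Mf f₀ ≠ 0 := fun h => indicatorSB_top_ne_zero (Mf.injective (by rw [h, map_zero]))
  obtain ⟨k, hk⟩ : ∃ k, ((Mf f₀ : FinSB F ι) : (ι → FiniteAdeleRing (𝓞 F) F) → ℂ) k ≠ 0 := by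
    by_contra hcon
    push Not at hcon
    exact hMf0 (Subtype.ext (funext fun k => by rw [hcon k]; rfl))
  -- the implementing identity on the archimedean Heisenberg element `((a, w)_∞, 0)` and the pure tensor `Φ ⊗ f₀`
  have hact : (ofSymplectic (polar (adelicForm F ι T)) g).act
      (⟨(archVec F ι a, archVec F ι w), 0⟩ : AdelicHeisenberg F ι T) =
      (⟨(archVec F ι (archAct T g (a, w)).1, archVec F ι (archAct T g (a, w)).2),
        0 + (ofSymplectic (polar (adelicForm F ι T)) g).f (archVec F ι a, archVec F ι w)⟩ : AdelicHeisenberg F ι T) := by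
    apply Heisenberg.ext
    · rw [Heisenberg.PseudoSymplectic.act_v, ofSymplectic_σ]
      exact apply_archVec_pair T g a w
    · rw [Heisenberg.PseudoSymplectic.act_t]
  have key := hImp (⟨(archVec F ι a, archVec F ι w), 0⟩ : AdelicHeisenberg F ι T) (piSchwartzBruhatEquiv F ι (Φ ⊗ₜ f₀))
  rw [hact, adelicSchrodinger_mk_archVec_tmul, AddChar.map_zero_eq_one, Circle.coe_one, one_smul, hp, hp,
    adelicSchrodinger_mk_archVec_tmul, zero_add] at key
  -- `key : Ψ(A ρ(a,w)Φ ⊗ M_f f₀) = ψ(f_g) • Ψ(ρ(g(a,w)) AΦ ⊗ M_f f₀)`; evaluate at `(u, k)` and cancel `(M_f f₀)(k)`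
  have hphase : ((adeleAddChar F ((ofSymplectic (polar (adelicForm F ι T)) g).f (archVec F ι a, archVec F ι w)) :
      Circle) : ℂ) = weilPhase T g (a, w) := rfl
  ext u
  have hu := congrArg (fun Ψ : piSchwartzBruhat F ι => (Ψ : (ι → AdeleRing (𝓞 F) F) → ℂ) (piAdeleSplit F ι (u, k))) key
  simp only [Submodule.coe_smul, Pi.smul_apply, smul_eq_mul, coe_piSchwartzBruhatEquiv_tmul_piAdeleSplit] at hu
  rw [hphase] at hu
  rw [_root_.smul_apply, smul_eq_mul]
  have hu' : (A (archModTrans F ι T a w Φ)) u * ((Mf f₀ : FinSB F ι) : (ι → FiniteAdeleRing (𝓞 F) F) → ℂ) k =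
      (weilPhase T g (a, w) * (archModTrans F ι T (archAct T g (a, w)).1 (archAct T g (a, w)).2 (A Φ)) u) *
        ((Mf f₀ : FinSB F ι) : (ι → FiniteAdeleRing (𝓞 F) F) → ℂ) k := by
    rw [hu, mul_assoc]
  exact mul_right_cancel₀ hk hu'

/-- the same for an element of `Mp_ψ(W_𝔸)ᶜᵒⁿᵗ`. [cite: Weil1964, Chap. III n° 37–38 pp. 188–190] -/
theorem archCovariant_of_map_tmul' (p : adelicMpCont F ι T)
    (A : 𝓢((ι → mixedSpace F), ℂ) ≃L[ℂ] 𝓢((ι → mixedSpace F), ℂ)) (Mf : FinSB F ι ≃ₗ[ℂ] FinSB F ι)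
    (hp : ∀ (Φ : 𝓢((ι → mixedSpace F), ℂ)) (f : FinSB F ι),
      ((p : adelicMp F ι T) : symplecticGroup (polar (adelicForm F ι T)) ×
          (piSchwartzBruhat F ι ≃ₗ[ℂ] piSchwartzBruhat F ι)).2 (piSchwartzBruhatEquiv F ι (Φ ⊗ₜ f)) =
        piSchwartzBruhatEquiv F ι (A Φ ⊗ₜ Mf f))
    (a w : ι → mixedSpace F) (Φ : 𝓢((ι → mixedSpace F), ℂ)) :
    A (archModTrans F ι T a w Φ) =
      weilPhase T (adelicMpCont.proj F ι T p) (a, w) •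
        archModTrans F ι T (archAct T (adelicMpCont.proj F ι T p) (a, w)).1
          (archAct T (adelicMpCont.proj F ι T p) (a, w)).2 (A Φ) :=
  archCovariant_of_map_tmul (p : adelicMp F ι T) A Mf hp a w Φ

end Literature.NumberTheory.Weil1964

end
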